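import Mathlib
import Summits.NavierStokesRegularity.FluidComputer.AbcClassIDefs
import Summits.NavierStokesRegularity.FluidComputer.AbcClassIISynthesis

/-!
# Class-I layer of the ABC certificate chains, Part S: sections, band, and closure properties of class I
(profile-cert-3 g9 — F5 implementation-3 seat, cell `ns-blowup`, 2026-08-27; the class-I twin of the
`Idx`-part of instab4 g6's `AbcClassIIOrbits` and of `AbcClassIISymmetry`)

HONEST FRAMING (human rulings D-0035/D-0074): nothing here is a claim about Navier–Stokes blow-up.
WHAT THIS IS NOT: not NS evidence. MODEL lane (linearisation about the forced ABC flow 1:1:1, class I).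
Sequel of `AbcClassIDefs`.

* §O Membership / monotonicity / exhaustion of the class-I section index sets `cubeIdx n` and the band
  `nbrIdx i` (the five `Idx`-lemmas of `AbcClassIIOrbits`; everything else there is character-free and is
  used by name).
* §S CLOSURE PROPERTIES of CLASS I (`IsClassI`, the trivial character `ρ_r c = c`, `ρ_s c = c`): preserved
  by scalar multipliers invariant under the two frequency maps, by the diagonal part `(x + |k|²/R)·`, by
  `Π X` (instab3's `AbcLatticeSymmetry.linOp_abcFlow_class_invariant` with `χ = 1` for BOTH generators, at
  `ν = 0`, and `Π[N+N] = −2π ΠX` — `AbcClassII.linOp_zero_eq`), hence by the section operator; by the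
  conjugation `J c = conj c(−·)`; by cuts to orbit-closed frequency sets; by `−` and `−`.
  (Conjugate symmetry / transversality lemmas are character-free: `AbcClassII.isConjSymm_secOp`,
  `kdot_secOp`, `isConjSymm_cut`, `kdot_cut`, `isConjSymm_lerayCrossForm`, `kdot_conj`, … by name.)

Mathlib + the files named; no new definitions. bears_on LADDER-NS N5 / Z4-a(1) (CR rows T2/T4).
-/

noncomputable section

open scoped BigOperators ComplexConjugate InnerProductSpace
open Finset MeasureTheory UnitAddTorus

namespace Summit.NavierStokesRegularity.FluidComputer.AbcClassI

open Literature.Analysis.FunctionSpaces Literature.Analysis.FunctionSpaces.Torus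
open Literature.Analysis.FunctionSpaces.EuclideanSpace
open Literature.Analysis.FluidPDE Literature.Analysis.FluidPDE.SteadyLattice
open Literature.Analysis.FluidPDE.ScalarFourier
open Summit.NavierStokesRegularity.FluidComputer.AbcClassII (Fam crossForm secOp rotR rotS sgnAct sgnOrbit
  cube extend restrictTo extend_add extend_smul extend_zero rotR_add rotR_smul rotS_add rotS_smul
  crossForm_add crossForm_smul secOp_add secOp_smul restrictTo_add restrictTo_smul Orbit toOrbit onormSq
  osupNorm cubeOrbits nbrOrbits mem_sgnOrbit mem_sgnOrbit_self card_sgnOrbit_le sgnOrbit_eq_of_mem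
  mem_sgnOrbit_comm sgnOrbit_eq_or_disjoint neg_mem_sgnOrbit neg_self_mem_sgnOrbit rotFreqR_mem_sgnOrbit
  rotFreqS_mem_sgnOrbit freqNormSq_eq_of_mem_sgnOrbit supNorm_eq_of_mem_sgnOrbit mem_cube
  mem_cube_iff_supNorm cube_mono sgnOrbit_subset_cube zero_not_mem_sgnOrbit ne_zero_of_mem_sgnOrbit
  toOrbit_val toOrbit_eq_iff mem_cubeOrbits mem_nbrOrbits mem_nbrOrbits_comm card_nbrOrbits_le rotR_apply
  rotS_apply freqNormSq_rotFreq secOp_conj isConjSymm_secOp kdot_secOp mem_iff_of_orbitClosed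
  isConjSymm_cut kdot_cut orbitClosed_cube_ne_zero orbitClosed_shell neg_mem_of_orbitClosed
  isConjSymm_lerayCrossForm kdot_conj conj_eq_zero_of_not_mem linOp_zero_eq conj_theta_neg
  extend_apply_of_mem extend_apply_of_not_mem restrictTo_extend extend_restrictTo extend_sum
  inner_eq_sum_extend inner_conjVec_conjVec conj_sum_inner_of_isConjSymm sum_inner_eq_re_of_isConjSymm
  real_inner_eq_re real_smul_eq norm_lerayCrossForm_le sobolevWeight_one_eq)

/-! ## Part O. The class-I section index sets and the band -/

section Orbits

/-- Membership in `cubeIdx n`. -/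
theorem mem_cubeIdx {n : ℕ} {i : AbcClassI.Idx} : i ∈ AbcClassI.cubeIdx n ↔ osupNorm i.1 ≤ n := by
  refine (Finset.mem_sigma (s := cubeOrbits n) (t := fun O => (Finset.univ : Finset (Fin (odim O))))
    (a := i)).trans ?_
  simp [mem_cubeOrbits]

/-- The section index sets are monotone. -/
theorem cubeIdx_mono : Monotone AbcClassI.cubeIdx := fun _ _ h _ hi =>
  mem_cubeIdx.mpr ((mem_cubeIdx.mp hi).trans h)

/-- The section index sets exhaust the index type. -/
theorem exists_mem_cubeIdx (i : AbcClassI.Idx) : ∃ n, i ∈ AbcClassI.cubeIdx n := ⟨osupNorm i.1, mem_cubeIdx.mpr le_rfl⟩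

/-- Membership in `nbrIdx i`. -/
theorem mem_nbrIdx {i j : AbcClassI.Idx} : j ∈ AbcClassI.nbrIdx i ↔ j.1 ∈ nbrOrbits i.1 := by
  refine (Finset.mem_sigma (s := nbrOrbits i.1) (t := fun O => (Finset.univ : Finset (Fin (odim O))))
    (a := j)).trans ?_
  simp

/-- The band is symmetric. -/
theorem mem_nbrIdx_comm (i j : AbcClassI.Idx) : j ∈ AbcClassI.nbrIdx i ↔ i ∈ AbcClassI.nbrIdx j := by
  rw [mem_nbrIdx, mem_nbrIdx, mem_nbrOrbits_comm]

end Orbits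

/-! ## Part S. Class I: closure properties -/

section Symmetry

/-- Hypothesis `hc` of `AbcLatticeSymmetry.linOp_abcFlow_class_invariant` for the generator `r` (`χ = 1`)
from class I. -/
theorem hr_of_isClassI {c : Fam} (hc : IsClassI c) (m : Fin 3 → ℤ) (p : Fin 3) :
    (fun _ : Fin 3 → ℤ => (1 : ℂ)) m * ((((fun _ : Fin 3 => (1 : ℤ)) p : ℤ) : ℂ) * c
      (fun i : Fin 3 => (fun _ : Fin 3 => (1 : ℤ)) ((finRotate 3).symm i) * m ((finRotate 3).symm i))
        ((finRotate 3) p)) = 1 * c m p := by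
  have h := congrArg (fun f : Fam => f m p) hc.1
  simp only [rotR_apply] at h
  simp only [Int.cast_one, one_mul]
  exact h

/-- Hypothesis `hc` of `AbcLatticeSymmetry.linOp_abcFlow_class_invariant` for the generator `s` (`χ = 1`)
from class I. -/
theorem hs_of_isClassI {c : Fam} (hc : IsClassI c) (m : Fin 3 → ℤ) (p : Fin 3) :
    (fun n : Fin 3 → ℤ => (-Complex.I) ^ (n 0 + 3 * n 1 + n 2)) m *
      ((((![1, 1, -1] : Fin 3 → ℤ) p : ℤ) : ℂ) * c
        (fun i : Fin 3 => (![1, 1, -1] : Fin 3 → ℤ) ((Equiv.swap (1 : Fin 3) 2).symm i) *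
          m ((Equiv.swap (1 : Fin 3) 2).symm i)) ((Equiv.swap (1 : Fin 3) 2) p)) = 1 * c m p := by
  have h := congrArg (fun f : Fam => f m p) hc.2
  simp only [rotS_apply] at h
  rw [h]; ring

/-- A scalar multiplier invariant under the two frequency maps preserves class I. -/
theorem IsClassI.smul_fun {c : Fam} (hc : IsClassI c) (f : (Fin 3 → ℤ) → ℂ)
    (hfr : ∀ m, f (fun i : Fin 3 => m ((finRotate 3).symm i)) = f m)
    (hfs : ∀ m, f (fun i : Fin 3 => (![1, 1, -1] : Fin 3 → ℤ) ((Equiv.swap (1 : Fin 3) 2).symm i) *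
      m ((Equiv.swap (1 : Fin 3) 2).symm i)) = f m) :
    IsClassI (fun k => f k • c k) := by
  refine ⟨?_, ?_⟩
  · funext m; ext p
    have h := congrArg (fun g : Fam => g m p) hc.1
    simp only [rotR_apply] at h
    simp only [rotR_apply, PiLp.smul_apply, smul_eq_mul, hfr, h]
  · funext m; ext p
    have h := congrArg (fun g : Fam => g m p) hc.2
    simp only [rotS_apply] at h
    simp only [rotS_apply, PiLp.smul_apply, smul_eq_mul, hfs]
    rw [← h]; ring

/-- The diagonal part `k ↦ (x + |k|²/R) c(k)` of the section operator preserves class I. -/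
theorem IsClassI.diag {c : Fam} (hc : IsClassI c) (R x : ℝ) :
    IsClassI (fun k => ((x + freqNormSq k / R : ℝ) : ℂ) • c k) :=
  hc.smul_fun _ (fun m => by rw [(freqNormSq_rotFreq m).1]) (fun m => by rw [(freqNormSq_rotFreq m).2])

/-- **Class I is invariant under `Π X`** (instab3's `AbcLatticeSymmetry.linOp_abcFlow_class_invariant` with
the trivial character `χ = 1` for both generators, at `ν = 0`, and `Π[N+N] = −2π ΠX`). -/
theorem IsClassI.lerayCrossForm {c : Fam} (hc : IsClassI c) :
    IsClassI (fun k => Torus.lerayCoeff k (crossForm 1 1 1 c k)) := by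
  have H1 := fun k p => AbcLatticeSymmetry.linOp_abcFlow_class_invariant (finRotate 3)
    (fun _ : Fin 3 => (1 : ℤ)) AbcLatticeSymmetryGenerators.sigma_theta_r.1 (fun _ : Fin 3 → ℤ => (1 : ℂ))
    AbcLatticeSymmetryGenerators.sigma_theta_r.2 1 1 1 0 (AbcLatticeSymmetryGenerators.abcFourier_invariant_r 1)
    1 c (hr_of_isClassI hc) k p
  have H2 := fun k p => AbcLatticeSymmetry.linOp_abcFlow_class_invariant (Equiv.swap (1 : Fin 3) 2)
    (![1, 1, -1] : Fin 3 → ℤ) AbcLatticeSymmetryGenerators.sigma_theta_s.1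
    (fun n : Fin 3 → ℤ => (-Complex.I) ^ (n 0 + 3 * n 1 + n 2)) AbcLatticeSymmetryGenerators.sigma_theta_s.2
    1 1 1 0 (AbcLatticeSymmetryGenerators.abcFourier_invariant_s 1) 1 c (hs_of_isClassI hc) k p
  have hπ : (-(2 * Real.pi : ℂ)) ≠ 0 := by
    have : (Real.pi : ℂ) ≠ 0 := by exact_mod_cast Real.pi_ne_zero
    exact neg_ne_zero.mpr (mul_ne_zero two_ne_zero this)
  have hY : IsClassI (fun k => (-(2 * Real.pi : ℂ)) • Torus.lerayCoeff k (crossForm 1 1 1 c k)) := by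
    refine ⟨?_, ?_⟩
    · funext m; ext p
      have h := H1 m p
      rw [AbcClassII.linOp_zero_eq, AbcClassII.linOp_zero_eq] at h
      simp only [Int.cast_one, one_mul] at h
      rw [rotR_apply]
      exact h
    · funext m; ext p
      have h := H2 m p
      rw [AbcClassII.linOp_zero_eq, AbcClassII.linOp_zero_eq] at h
      rw [rotS_apply, h]
      ring
  have h := hY.smul ((-(2 * Real.pi : ℂ))⁻¹)
  have e : ((-(2 * Real.pi : ℂ))⁻¹ • fun k => (-(2 * Real.pi : ℂ)) • Torus.lerayCoeff k (crossForm 1 1 1 c k)) =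
      fun k => Torus.lerayCoeff k (crossForm 1 1 1 c k) := by
    funext k
    rw [Pi.smul_apply, smul_smul, inv_mul_cancel₀ hπ, one_smul]
  rw [e] at h
  exact h

/-- **The section operator preserves class I.** -/
theorem IsClassI.secOp {c : Fam} (hc : IsClassI c) (R x : ℝ) : IsClassI (secOp R x c) := by
  have e : AbcClassII.secOp R x c = (fun k => ((x + freqNormSq k / R : ℝ) : ℂ) • c k) +
      (-1 : ℂ) • (fun k => Torus.lerayCoeff k (crossForm 1 1 1 c k)) := by
    funext k; simp [AbcClassII.secOp, sub_eq_add_neg]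
  rw [e]
  exact (hc.diag R x).add (hc.lerayCrossForm.smul _)

/-- **The conjugation `J c = conj c(−·)` preserves class I.** -/
theorem IsClassI.conj {c : Fam} (hc : IsClassI c) : IsClassI (fun k => conjVec (c (-k))) := by
  refine ⟨?_, ?_⟩
  · funext m; ext p
    rw [rotR_apply, conjVec_apply, conjVec_apply]
    have h := congrArg (fun g : Fam => g (-m) p) hc.1
    simp only [rotR_apply] at h
    have e : (-fun i : Fin 3 => m ((finRotate 3).symm i)) = fun i : Fin 3 => (-m) ((finRotate 3).symm i) := by
      funext i; simp
    rw [e, h]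
  · funext m; ext p
    rw [rotS_apply, conjVec_apply, conjVec_apply]
    have h := congrArg (fun g : Fam => g (-m) p) hc.2
    simp only [rotS_apply, Pi.neg_apply] at h
    have e : (-fun i : Fin 3 => (![1, 1, -1] : Fin 3 → ℤ) ((Equiv.swap (1 : Fin 3) 2).symm i) *
        m ((Equiv.swap (1 : Fin 3) 2).symm i)) = fun i : Fin 3 =>
        (![1, 1, -1] : Fin 3 → ℤ) ((Equiv.swap (1 : Fin 3) 2).symm i) * (-m) ((Equiv.swap (1 : Fin 3) 2).symm i) := by
      funext i; simp
    rw [e]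
    have hc' := congrArg (starRingEnd ℂ) h
    rw [map_mul, map_mul, map_intCast, conj_theta_neg] at hc'
    exact hc'

/-- Cutting a class-I family down to an orbit-closed set keeps it class I. -/
theorem IsClassI.cut {c : Fam} (hc : IsClassI c) {S : Finset (Fin 3 → ℤ)} (hS : ∀ k ∈ S, sgnOrbit k ⊆ S) :
    IsClassI (fun k => if k ∈ S then c k else 0) := by
  refine ⟨?_, ?_⟩
  · funext m; ext p
    have h := congrArg (fun g : Fam => g m p) hc.1
    simp only [rotR_apply] at h
    rw [rotR_apply]
    by_cases hm : m ∈ S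
    · rw [if_pos hm, if_pos ((mem_iff_of_orbitClosed hS (rotFreqR_mem_sgnOrbit m)).mp hm), h]
    · rw [if_neg hm, if_neg (fun h' => hm ((mem_iff_of_orbitClosed hS (rotFreqR_mem_sgnOrbit m)).mpr h'))]
      simp
  · funext m; ext p
    have h := congrArg (fun g : Fam => g m p) hc.2
    simp only [rotS_apply] at h
    rw [rotS_apply]
    by_cases hm : m ∈ S
    · rw [if_pos hm, if_pos ((mem_iff_of_orbitClosed hS (rotFreqS_mem_sgnOrbit m)).mp hm), h]
    · rw [if_neg hm, if_neg (fun h' => hm ((mem_iff_of_orbitClosed hS (rotFreqS_mem_sgnOrbit m)).mpr h'))]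
      simp

/-- Class I is closed under negation. -/
theorem IsClassI.neg {c : Fam} (hc : IsClassI c) : IsClassI (-c) := by
  have h := hc.smul (-1 : ℂ)
  rwa [neg_one_smul] at h

/-- Class I is closed under subtraction. -/
theorem IsClassI.sub {c d : Fam} (hc : IsClassI c) (hd : IsClassI d) : IsClassI (c - d) := by
  rw [sub_eq_add_neg]; exact hc.add hd.neg

/-- Finite sums of class-I families are class I. -/
theorem isClassI_sum {ι : Type*} (T : Finset ι) (f : ι → Fam) (hf : ∀ a ∈ T, IsClassI (f a)) :
    IsClassI (∑ a ∈ T, f a) := by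
  classical
  induction T using Finset.induction_on with
  | empty => rw [Finset.sum_empty]; exact isClassI_zero
  | insert a T ha ih =>
    rw [Finset.sum_insert ha]
    exact (hf a (Finset.mem_insert_self a T)).add (ih fun b hb => hf b (Finset.mem_insert_of_mem hb))

end Symmetry

end Summit.NavierStokesRegularity.FluidComputer.AbcClassI

end
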